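import Literature.MathematicalPhysics.QuantumLattice.LiebRobinsonFnwGapGramProofs
import HarnessLib

/-!
# Convergence of the transfer-operator iterates in the normalised gauge

Sibling proof file of `Literature/MathematicalPhysics/QuantumLattice/LiebRobinson.lean`
(theorem-only: no definition, no named fact), a step towards the discharge of
`fannes_nachtergaele_werner_gap` (**hubbard.S16**; Fannes–Nachtergaele–Werner 1992, Thm. 6.4). It
supplies the analytic input consumed (as an explicit entrywise hypothesis) by
`LiebRobinsonFnwGapGramProofs.lean` / `…OverlapProofs.lean`:

* `transferOp_pow_single_sub_entry_le` — for a tensor injective at some length, in the normalised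
  gauge `𝔼(𝟙) = 𝟙`, `𝔼†(ρ) = ρ` (`ρ ≥ 0`, `tr ρ = 1`): for every `ε > 0` there is `n₀` such that for
  all `n ≥ n₀` every entry of `𝔼ⁿ(e_a e_dᵀ) - ρ_{da} 𝟙` has modulus `≤ ε`, i.e. `𝔼ⁿ → (X ↦ tr (ρ X) 𝟙)`.

The proof is the Doeblin (minorisation + oscillation-contraction) argument of
`TransferOperatorMinorisation.lean` (`IsInjectiveMPS.exists_minorisation` with `X₀ = 𝟙`,
`doeblin_iterate`, `enclosure_pow_of_posSemidef`): for Hermitian `Y`, `𝔼^{mk}(Y)` is enclosed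
between `a' 𝟙` and `b' 𝟙` with `b' - a' = (1 - δ D)^k · 2‖Y‖`, the enclosure persists under further
iterates and contains the conserved centre `tr (ρ Y)`, whence
`‖𝔼ⁿ(Y) - tr (ρ Y) 𝟙‖ ≤ (1 - δ D)^k · 2‖Y‖` (`norm_le_of_posSemidef_sub_add`); a matrix unit is a
combination of two Hermitian matrices, and entries are bounded by the operator norm
(`norm_apply_le_l2_opNorm`). This replaces the spectral argument (trivial peripheral spectrum,
Jordan form) behind FNW's (5.1) "`𝔼ⁿ - 𝔼^∞ = O(a(n))`".

## Source

* M. Fannes, B. Nachtergaele, R. F. Werner, Comm. Math. Phys. **144** (1992) 443–490, §5, (5.1)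
  and Lemma 5.2 (the convergence `𝔼ⁿ → 𝔼^∞`, `𝔼^∞(B) = tr (ρ B) 𝟙` in the normalisation (5.3)).
  [FannesNachtergaeleWernerCMP1992]
* R. L. Dobrushin, Theory Probab. Appl. **1** (1956) 65–80 (oscillation contraction), as organised in
  `TransferOperatorMinorisation.lean`.
-/

noncomputable section

open Matrix
open scoped ComplexOrder MatrixOrder Matrix.Norms.L2Operator

namespace Literature.MathematicalPhysics.QuantumLattice

section QLattice

variable {q D : ℕ}

/-! ### Entries are bounded by the operator norm -/

/-- Every entry of a matrix is bounded by its `L²`-operator norm: `|M_{ij}| ≤ ‖M‖`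
(`M_{ij} = (M e_j)_i`). [folklore] -/
theorem norm_apply_le_l2_opNorm {n : Type*} [Fintype n] [DecidableEq n] (M : Matrix n n ℂ)
    (i j : n) : ‖M i j‖ ≤ ‖M‖ := by
  have h := l2_opNorm_mulVec M (EuclideanSpace.single j (1 : ℂ))
  rw [PiLp.norm_single, norm_one, mul_one] at h
  refine le_trans ?_ h
  have hs : (⇑(EuclideanSpace.single j (1 : ℂ)) : n → ℂ) = Pi.single j 1 :=
    funext fun k => by simp [Pi.single_apply, eq_comm]
  have h2 := PiLp.norm_apply_le
    ((EuclideanSpace.equiv n ℂ).symm (M *ᵥ ⇑(EuclideanSpace.single j (1 : ℂ)))) i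
  have h3 : ((EuclideanSpace.equiv n ℂ).symm (M *ᵥ ⇑(EuclideanSpace.single j (1 : ℂ)))) i =
      M i j := by
    rw [hs, mulVec_single_one]
    rfl
  rw [h3] at h2
  exact h2

/-! ### Convergence `𝔼ⁿ(X) → tr (ρ X) 𝟙` in the normalised gauge -/

/-- **The iterates of a strictly contracting normalised transfer operator converge to the
projection `X ↦ tr (ρ X) 𝟙` (entrywise form on the matrix units).** For a tensor injective at a
positive length `m` in the normalised gauge `𝔼(𝟙) = 𝟙`, `𝔼†(ρ) = ρ` (`ρ ≥ 0`, `tr ρ = 1`), and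
every `ε > 0`, all entries of `𝔼ⁿ(e_a e_dᵀ) - ρ_{da} 𝟙` are `≤ ε` for `n` large. Proof: the
minorisation `𝔼ᵐ(Z) ≥ δ (tr Z) 𝟙` (`IsInjectiveMPS.exists_minorisation`, `X₀ = 𝟙`) and the
Doeblin contraction (`doeblin_iterate`) enclose `𝔼^{mk}(Y)` for Hermitian `Y` between `a' 𝟙` and
`b' 𝟙` with `b' - a' = (1 - δ D)^k · 2‖Y‖`; the enclosure persists under further iterates
(`enclosure_pow_of_posSemidef`) and contains the conserved centre `tr (ρ Y)`
(`𝔼†(ρ) = ρ`), so `‖𝔼ⁿ(Y) - tr(ρ Y) 𝟙‖ ≤ (1 - δ D)^k 2‖Y‖`; a matrix unit is a combination of two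
Hermitian matrices. This is the convergence `𝔼ⁿ → 𝔼^∞` (strict contraction, trivial peripheral
spectrum) of Fannes–Nachtergaele–Werner (1992) §5 (5.1) / Lemma 5.2, obtained here by the
Doeblin argument of `TransferOperatorMinorisation.lean` rather than by spectral theory.
[cite: FannesNachtergaeleWernerCMP1992, §5 (5.1)] -/
theorem transferOp_pow_single_sub_entry_le [NeZero D] {A : MPSTensor q D} {m : ℕ}
    (hA : IsInjectiveMPS A m) (h1 : transferOp A 1 = 1)
    {ρ : Matrix (Fin D) (Fin D) ℂ} (hρ : transferOp (fun i => (A i)ᴴ) ρ = ρ)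
    (hρpsd : ρ.PosSemidef) (hρtr : ρ.trace = 1) {ε : ℝ} (hε : 0 < ε) :
    ∃ n₀ : ℕ, ∀ n : ℕ, n₀ ≤ n → ∀ a d i j : Fin D,
      ‖((transferOp A ^ n) (Matrix.single a d 1) -
        ρ d a • (1 : Matrix (Fin D) (Fin D) ℂ)) i j‖ ≤ ε := by
  set T := transferOp A with hTdef
  -- minorisation with `X₀ = 𝟙`, and the contraction factor `θ = 1 - δ D`
  obtain ⟨δ, hδ, hmin⟩ := hA.exists_minorisation (X₀ := (1 : Matrix (Fin D) (Fin D) ℂ)) PosDef.one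
  set Φ : Matrix (Fin D) (Fin D) ℂ →ₗ[ℂ] Matrix (Fin D) (Fin D) ℂ := T ^ m with hΦdef
  have hΦ1 : Φ 1 = 1 := pow_apply_of_apply_eq T h1 m
  have hDtr : (1 : Matrix (Fin D) (Fin D) ℂ).trace.re = D := by
    rw [trace_one, Fintype.card_fin]; simp
  set θ : ℝ := 1 - δ * (1 : Matrix (Fin D) (Fin D) ℂ).trace.re with hθdef
  have hDpos : (0 : ℝ) < D := Nat.cast_pos.2 (Nat.pos_of_ne_zero (NeZero.ne D))
  have hθ1 : θ < 1 := by
    rw [hθdef, hDtr]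
    have : 0 < δ * D := mul_pos hδ hDpos
    linarith
  have hθ0 : 0 ≤ θ := by
    have h := hmin 1 PosSemidef.one
    rw [hΦ1, hDtr] at h
    have hd : 0 ≤ ((1 - ((δ * D : ℝ) : ℂ) • (1 : Matrix (Fin D) (Fin D) ℂ)) ⟨0, Nat.pos_of_ne_zero
      (NeZero.ne D)⟩ ⟨0, Nat.pos_of_ne_zero (NeZero.ne D)⟩).re := (Complex.nonneg_iff.1 h.diag_nonneg).1
    simp at hd
    rw [hθdef, hDtr]
    linarith
  have hpos : ∀ Z : Matrix (Fin D) (Fin D) ℂ, Z.PosSemidef → (T Z).PosSemidef := fun Z hZ =>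
    transferOp_posSemidef A hZ
  -- key bound for a Hermitian `Y`
  have key : ∀ (Y : Matrix (Fin D) (Fin D) ℂ), Y.IsHermitian → ∀ (k n : ℕ), m * k ≤ n →
      ∀ i j : Fin D, ‖((T ^ n) Y - (((ρ * Y).trace.re : ℝ) : ℂ) • (1 : Matrix (Fin D) (Fin D) ℂ)) i j‖ ≤
        θ ^ k * (2 * ‖Y‖) := by
    intro Y hY k n hn i j
    have ha : (Y - ((-‖Y‖ : ℝ) : ℂ) • (1 : Matrix (Fin D) (Fin D) ℂ)).PosSemidef := by
      have h := posSemidef_norm_smul_one_add hY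
      rw [Complex.ofReal_neg, neg_smul, sub_neg_eq_add, add_comm]
      exact h
    have hb : (((‖Y‖ : ℝ) : ℂ) • (1 : Matrix (Fin D) (Fin D) ℂ) - Y).PosSemidef :=
      posSemidef_norm_smul_one_sub hY
    obtain ⟨a', b', ha', hb', hw⟩ := doeblin_iterate Φ hmin hΦ1 k ha hb
    rw [hΦdef, ← pow_mul] at ha' hb'
    obtain ⟨r, rfl⟩ := Nat.exists_eq_add_of_le hn
    obtain ⟨hlo, hhi⟩ := enclosure_pow_of_posSemidef T hpos h1 ha' hb' r
    rw [← Module.End.mul_apply, ← pow_add, add_comm] at hlo hhi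
    -- the conserved centre
    set t : ℝ := (ρ * Y).trace.re with htdef
    have htn : (ρ * (T ^ (m * k + r)) Y).trace = (ρ * Y).trace := by
      rw [hTdef, trace_mul_transferOp_pow, pow_apply_of_apply_eq _ hρ]
    have hρtr' : ρ.trace.re = 1 := by rw [hρtr]; simp
    have hat : a' ≤ t := by
      have h := re_trace_mul_nonneg hρpsd hlo
      rw [Matrix.mul_sub, trace_sub, Matrix.mul_smul, Matrix.mul_one, trace_smul, smul_eq_mul,
        Complex.sub_re, Complex.re_ofReal_mul, htn, hρtr'] at h
      linarith
    have htb : t ≤ b' := by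
      have h := re_trace_mul_nonneg hρpsd hhi
      rw [Matrix.mul_sub, trace_sub, Matrix.mul_smul, Matrix.mul_one, trace_smul, smul_eq_mul,
        Complex.sub_re, Complex.re_ofReal_mul, htn, hρtr'] at h
      linarith
    -- `-w ≤ 𝔼ⁿ(Y) - t ≤ w`, `w = b' - a'`
    set M := (T ^ (m * k + r)) Y - ((t : ℝ) : ℂ) • (1 : Matrix (Fin D) (Fin D) ℂ) with hMdef
    have hTY : ((T ^ (m * k + r)) Y).IsHermitian := hlo.1.add (isHermitian_real_smul isHermitian_one a') |>
      fun h => by simpa using h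
    have hM : M.IsHermitian := hTY.sub (isHermitian_real_smul isHermitian_one t)
    have hw0 : 0 ≤ b' - a' := by linarith
    have h₁ : (((b' - a' : ℝ) : ℂ) • (1 : Matrix (Fin D) (Fin D) ℂ) - M).PosSemidef := by
      have e : ((b' - a' : ℝ) : ℂ) • (1 : Matrix (Fin D) (Fin D) ℂ) - M =
          (((b' : ℝ) : ℂ) • 1 - (T ^ (m * k + r)) Y) + ((t - a' : ℝ) : ℂ) • 1 := by
        rw [hMdef]; push_cast; module
      rw [e]
      exact hhi.add (PosSemidef.one.smul (Complex.zero_le_real.2 (by linarith)))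
    have h₂ : (((b' - a' : ℝ) : ℂ) • (1 : Matrix (Fin D) (Fin D) ℂ) + M).PosSemidef := by
      have e : ((b' - a' : ℝ) : ℂ) • (1 : Matrix (Fin D) (Fin D) ℂ) + M =
          ((T ^ (m * k + r)) Y - ((a' : ℝ) : ℂ) • 1) + ((b' - t : ℝ) : ℂ) • 1 := by
        rw [hMdef]; push_cast; module
      rw [e]
      exact hlo.add (PosSemidef.one.smul (Complex.zero_le_real.2 (by linarith)))
    have hnorm := norm_le_of_posSemidef_sub_add hM hw0 h₁ h₂
    calc ‖M i j‖ ≤ ‖M‖ := norm_apply_le_l2_opNorm M i j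
      _ ≤ b' - a' := hnorm
      _ = θ ^ k * (‖Y‖ - -‖Y‖) := hw
      _ = θ ^ k * (2 * ‖Y‖) := by ring
  -- Hermitian decomposition of the matrix units and a uniform norm bound
  set H₁ : Fin D → Fin D → Matrix (Fin D) (Fin D) ℂ := fun a d =>
    Matrix.single a d (1 : ℂ) + Matrix.single d a (1 : ℂ) with hH₁
  set H₂ : Fin D → Fin D → Matrix (Fin D) (Fin D) ℂ := fun a d =>
    Complex.I • (Matrix.single a d (1 : ℂ) - Matrix.single d a (1 : ℂ)) with hH₂
  have hsH : ∀ a d : Fin D, (Matrix.single a d (1 : ℂ))ᴴ = Matrix.single d a 1 := by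
    intro a d
    ext i j
    simp only [conjTranspose_apply, Matrix.single, of_apply]
    by_cases h : a = j ∧ d = i
    · obtain ⟨rfl, rfl⟩ := h
      simp
    · rw [if_neg h, if_neg (fun h' => h ⟨h'.2, h'.1⟩), star_zero]
  have hH₁h : ∀ a d, (H₁ a d).IsHermitian := by
    intro a d
    simp only [hH₁, IsHermitian, conjTranspose_add, hsH, add_comm]
  have hH₂h : ∀ a d, (H₂ a d).IsHermitian := by
    intro a d
    simp only [hH₂, IsHermitian, conjTranspose_smul, conjTranspose_sub, hsH, Complex.star_def,
      Complex.conj_I, neg_smul, ← smul_neg, neg_sub]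
  set W : ℝ := (∑ a : Fin D, ∑ d : Fin D, (‖H₁ a d‖ + ‖H₂ a d‖)) + 1 with hW
  have hW0 : 0 < W := by positivity
  have hWle : ∀ a d, ‖H₁ a d‖ + ‖H₂ a d‖ ≤ W := by
    intro a d
    have h1' : ‖H₁ a d‖ + ‖H₂ a d‖ ≤ ∑ d' : Fin D, (‖H₁ a d'‖ + ‖H₂ a d'‖) :=
      Finset.single_le_sum (f := fun d' => ‖H₁ a d'‖ + ‖H₂ a d'‖) (fun _ _ => by positivity)
        (Finset.mem_univ d)
    have h2' : ∑ d' : Fin D, (‖H₁ a d'‖ + ‖H₂ a d'‖) ≤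
        ∑ a' : Fin D, ∑ d' : Fin D, (‖H₁ a' d'‖ + ‖H₂ a' d'‖) :=
      Finset.single_le_sum (f := fun a' => ∑ d' : Fin D, (‖H₁ a' d'‖ + ‖H₂ a' d'‖))
        (fun _ _ => by positivity) (Finset.mem_univ a)
    linarith
  -- choose `k` with `θ^k W ≤ ε`
  obtain ⟨k, hk⟩ := exists_pow_lt_of_lt_one (div_pos hε hW0) hθ1
  refine ⟨m * k, fun n hn a d i j => ?_⟩
  -- the decomposition `e_a e_dᵀ = ½ (H₁ - I H₂)` and `ρ_{da} = ½ (tr ρH₁ - I tr ρH₂)`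
  have hdec : Matrix.single a d (1 : ℂ) = (1 / 2 : ℂ) • (H₁ a d - Complex.I • H₂ a d) := by
    simp only [hH₁, hH₂, smul_sub, smul_smul, Complex.I_mul_I, neg_smul, one_smul, sub_neg_eq_add]
    module
  have htr₁ : (ρ * H₁ a d).trace = (((ρ * H₁ a d).trace.re : ℝ) : ℂ) :=
    Complex.ext rfl (by rw [Complex.ofReal_im]; exact im_trace_mul_of_isHermitian hρpsd.1 (hH₁h a d))
  have htr₂ : (ρ * H₂ a d).trace = (((ρ * H₂ a d).trace.re : ℝ) : ℂ) :=
    Complex.ext rfl (by rw [Complex.ofReal_im]; exact im_trace_mul_of_isHermitian hρpsd.1 (hH₂h a d))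
  have hρda : (ρ d a : ℂ) = (1 / 2 : ℂ) * ((ρ * H₁ a d).trace - Complex.I * (ρ * H₂ a d).trace) := by
    simp only [hH₁, hH₂, Matrix.mul_add, Matrix.mul_sub, Matrix.mul_smul, trace_add, trace_sub,
      trace_smul, trace_mul_single, smul_eq_mul, MulOpposite.smul_eq_mul_unop, MulOpposite.unop_op,
      mul_one]
    ring_nf
    rw [Complex.I_sq]
    ring
  have hlin : (T ^ n) (Matrix.single a d 1) - ρ d a • (1 : Matrix (Fin D) (Fin D) ℂ) =
      (1 / 2 : ℂ) • (((T ^ n) (H₁ a d) - (((ρ * H₁ a d).trace.re : ℝ) : ℂ) • 1) -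
        Complex.I • ((T ^ n) (H₂ a d) - (((ρ * H₂ a d).trace.re : ℝ) : ℂ) • 1)) := by
    rw [hdec, LinearMap.map_smul, map_sub, LinearMap.map_smul, hρda, ← htr₁, ← htr₂]
    module
  rw [hlin]
  have e1 := key (H₁ a d) (hH₁h a d) k n hn i j
  have e2 := key (H₂ a d) (hH₂h a d) k n hn i j
  have hθk : θ ^ k ≤ ε / W := hk.le
  calc ‖((1 / 2 : ℂ) • (((T ^ n) (H₁ a d) - (((ρ * H₁ a d).trace.re : ℝ) : ℂ) • 1) -
        Complex.I • ((T ^ n) (H₂ a d) - (((ρ * H₂ a d).trace.re : ℝ) : ℂ) • 1))) i j‖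
      ≤ (1 / 2) * (θ ^ k * (2 * ‖H₁ a d‖) + θ ^ k * (2 * ‖H₂ a d‖)) := by
        rw [Matrix.smul_apply, Matrix.sub_apply, Matrix.smul_apply, smul_eq_mul, smul_eq_mul,
          norm_mul]
        refine mul_le_mul (by norm_num) ?_ (norm_nonneg _) (by norm_num)
        refine (norm_sub_le _ _).trans (add_le_add e1 ?_)
        rw [norm_mul, Complex.norm_I, one_mul]
        exact e2
    _ = θ ^ k * (‖H₁ a d‖ + ‖H₂ a d‖) := by ring
    _ ≤ ε / W * W := mul_le_mul hθk (hWle a d) (by positivity) (by positivity)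
    _ = ε := div_mul_cancel₀ ε hW0.ne'

end QLattice

end Literature.MathematicalPhysics.QuantumLattice
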